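import Summits.CriticalPhenomena.Ising3DConformalLimit.Theorems.ArmDressingArmDressingGlueInvDefs
import Summits.CriticalPhenomena.Ising3DConformalLimit.Theorems.ArmDressingArmDressingGlueInvSystems
import Literature.Geometry.Euclidean.InversionBalls
import HarnessLib

/-!
# Crux `ArmDressingGlue` (stmt-CriticalPhenomena-15700), stub 3' — part 2: the even-pattern factor `q` is
# INVARIANT under the unit inversion

Camia–Feng §3.2.3 transposed, first half.  Fix `n` points `z_j ≠ 0` (pairwise distinct), a radius
`0 < r < ‖z_j‖` with the closed balls `B̄(z_j, r)` pairwise disjoint, and the inverted data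
`z*_j = z_j/‖z_j‖²`, `c*_j = z_j/(‖z_j‖² - r²)`, `r*_j = r/(‖z_j‖² - r²)` (the image balls, again pairwise
disjoint, `z*_j ∈ B(c*_j, r*_j)` — `Literature/Geometry/Euclidean/InversionBalls.lean`).  If `q` is a witness of
clause (ii) of crux B at `z` for the system `(z, r)` (`BFam n z r z (q z)`) and `q*` one at `z*` for the system
`(c*, r*)`, then `q* z* = q z` — PROVIDED crux A holds for the relation sets `EVEN2 ∩ CROSS` and `CROSS`
(limits `lam₁`, `lam₂` of the ball-connection laws, inversion invariant) AND the CROSS law is non-degenerate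
(`CrossLawPositive`, so that `lam₂ > 0` and the ratio limits of B(ii) ARE the ratios `lam₁/lam₂`):

* z-side: inner family `B̄(z_j, η)`; the B(ii) ratio tends (δ → 0⁺) to `lam₁(p_η)/lam₂(p_η)`,
  `p_η = (z_j, η)_j ++ (z_j, -r)_j`, hence `lam₁(p_η)/lam₂(p_η) → q z` as `η → 0⁺`;
* z*-side: the IMAGE inner family `ginv (z_j, η)` is admissible at `z*` (off-centred by `O(η²)`), its data is
  `ginv ∘ p_η`, and `lamₖ(ginv ∘ p_η) = lamₖ(p_η)` by the inversion clause of A; hence the same function of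
  `η` tends to `q* z*`, and `q* z* = q z` by uniqueness of limits.

Registered bookkeeping stub proved here: `stub_invQTransport`.  No definitions, no named facts, no sorry.

Reference: F. Camia, Y. Feng, arXiv:2411.01467, §3.2.3 (term `T₂`), Lemmas 12 and 14.
-/

noncomputable section

namespace Summit.CriticalPhenomena.Ising3DConformalLimit.Cruxes.ArmDressingGlue.InvBook

open scoped BigOperators Topology
open Filter Set Metric EuclideanGeometry
open Literature.Probability.LatticeModels Literature.Probability.Percolation
open Literature.Barriers.CriticalPhenomena Literature.Geometry.Euclidean
open Summit.CriticalPhenomena.Ising3DConformalLimit.Theses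
open Summit.CriticalPhenomena.Ising3DConformalLimit.Cruxes.ArmDressingGlue.Vocab

/-! ### Non-degeneracy: positive limits of the CROSS law -/

/-- Under `CrossLawPositive`, the limit law `lam` of crux A for `R = CROSS n` is positive at every
non-degenerate datum. [cite: CamiaFeng2025, §3.2.2 proof of Lemma 15] -/
theorem lam_cross_pos (hPos : CrossLawPositive) {n : ℕ} {lam : (Fin (n + n) → EuclideanSpace ℝ (Fin 3) × ℝ) → ℝ}
    (hlam : BallLaw (n + n) (CROSS n) lam) (p : Fin (n + n) → EuclideanSpace ℝ (Fin 3) × ℝ)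
    (hp : ∀ i, (p i).2 ≠ 0) : 0 < lam p := by
  obtain ⟨c, hc, hev⟩ := hPos n p hp
  exact lt_of_lt_of_le hc (ge_of_tendsto (hlam.2.1 p hp) hev)

/-! ### The data of the system at `z`: inner balls `(z_j, η)` ++ outer exteriors `(z_j, -r)` -/

/-- Radii of the data `p_η` are non-zero (`η ≠ 0`, `r ≠ 0`). [folklore] -/
theorem radii_ne_zero_append {n : ℕ} (z : Fin n → EuclideanSpace ℝ (Fin 3)) {η r : ℝ} (hη : η ≠ 0)
    (hr : r ≠ 0) : ∀ i, (Fin.append (fun j => (z j, η)) (fun j => (z j, -r)) i).2 ≠ 0 := by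
  intro i
  refine Fin.addCases (fun j => ?_) (fun j => ?_) i
  · simp only [Fin.append_left]; exact hη
  · simp only [Fin.append_right]; exact neg_ne_zero.2 hr

/-- The inversion guard `‖c‖ ≠ |radius|` for the data `p_η` (`0 < η < ‖z_j‖`, `0 < r < ‖z_j‖`). [folklore] -/
theorem guard_append {n : ℕ} (z : Fin n → EuclideanSpace ℝ (Fin 3)) {η r : ℝ} (hη : 0 < η)
    (hηz : ∀ j, η < ‖z j‖) (hr : 0 < r) (hrz : ∀ j, r < ‖z j‖) :
    ∀ i, (Fin.append (fun j => (z j, η)) (fun j => (z j, -r)) i).2 ≠ 0 ∧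
      ‖(Fin.append (fun j => (z j, η)) (fun j => (z j, -r)) i).1‖ ≠
        |(Fin.append (fun j => (z j, η)) (fun j => (z j, -r)) i).2| := by
  intro i
  refine Fin.addCases (fun j => ?_) (fun j => ?_) i
  · simp only [Fin.append_left]
    exact ⟨hη.ne', by rw [abs_of_pos hη]; exact (hηz j).ne'⟩
  · simp only [Fin.append_right]
    exact ⟨neg_ne_zero.2 hr.ne', by rw [abs_neg, abs_of_pos hr]; exact (hrz j).ne'⟩

/-- The image data: `ginv ∘ p_η = (ĉ_j(η), ρ̂_j(η))_j ++ (c*_j, -r*_j)_j`. [folklore] -/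
theorem ginv_append_data {n : ℕ} (z : Fin n → EuclideanSpace ℝ (Fin 3)) (η r : ℝ) :
    (fun i => ginv (Fin.append (fun j => (z j, η)) (fun j => (z j, -r)) i)) =
      Fin.append (fun j => ((‖z j‖ ^ 2 - η ^ 2)⁻¹ • z j, η / (‖z j‖ ^ 2 - η ^ 2)))
        (fun j => ((‖z j‖ ^ 2 - r ^ 2)⁻¹ • z j, -(r / (‖z j‖ ^ 2 - r ^ 2)))) := by
  rw [ginv_append]
  have h2 : (fun j => ginv (z j, -r)) =
      fun j => ((‖z j‖ ^ 2 - r ^ 2)⁻¹ • z j, -(r / (‖z j‖ ^ 2 - r ^ 2))) :=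
    funext fun j => ginv_neg_radius (z j) r
  rw [h2]
  rfl

/-! ### The B(ii) ratio limits are the ratios `lam₁/lam₂` -/

/-- **z-side.**  If `BFam n c r z t` holds (clause (ii) of B at `z`, target `t`), crux A gives limit laws
`lam₁` (for `EVEN2 ∩ CROSS`) and `lam₂` (for `CROSS`), and `lam₂ > 0` on non-degenerate data, then with the
centred inner family `B̄(z_j, η)`: `lam₁(p_η)/lam₂(p_η) → t` as `η → 0⁺`,
`p_η = (z_j, η)_j ++ (c_j, -r_j)_j`. [cite: CamiaFeng2025, Lemma 14] -/
theorem tendsto_lam_ratio_of_BFam {n : ℕ} {c z : Fin n → EuclideanSpace ℝ (Fin 3)} {r : Fin n → ℝ}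
    {t : ℝ} (hr : ∀ j, 0 < r j) (hB : BFam n c r z t)
    {lam₁ lam₂ : (Fin (n + n) → EuclideanSpace ℝ (Fin 3) × ℝ) → ℝ}
    (h₁ : BallLaw (n + n) (EVEN2 n ∩ CROSS n) lam₁) (h₂ : BallLaw (n + n) (CROSS n) lam₂)
    (h₂pos : ∀ p : Fin (n + n) → EuclideanSpace ℝ (Fin 3) × ℝ, (∀ i, (p i).2 ≠ 0) → 0 < lam₂ p) :
    Tendsto (fun η => lam₁ (Fin.append (fun j => (z j, η)) (fun j => (c j, -r j))) /
      lam₂ (Fin.append (fun j => (z j, η)) (fun j => (c j, -r j)))) (𝓝[>] 0) (𝓝 t) := by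
  -- the centred inner family
  obtain ⟨Λ, hΛ, hΛt⟩ := hB (fun _ j => z j) (fun η _ => η)
    (fun _ => tendsto_nhdsWithin_of_tendsto_nhds tendsto_id)
    (by filter_upwards [self_mem_nhdsWithin] with η hη j using ⟨hη, mem_ball_self (half_pos hη)⟩)
  refine hΛt.congr' ?_
  filter_upwards [hΛ, self_mem_nhdsWithin] with η hη hη0
  -- at such an `η` the ratio converges both to `Λ η` and to `lam₁/lam₂`
  have hrad : ∀ i, (Fin.append (fun j => (z j, η)) (fun j => (c j, -r j)) i).2 ≠ 0 := by
    intro i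
    refine Fin.addCases (fun j => ?_) (fun j => ?_) i
    · simp only [Fin.append_left]; exact (hη0 : 0 < η).ne'
    · simp only [Fin.append_right]; exact neg_ne_zero.2 (hr j).ne'
  have hN := h₁.2.1 _ hrad
  have hD := h₂.2.1 _ hrad
  have hfam : (fun i => disc · (gball (Fin.append (fun j => (z j, η)) (fun j => (c j, -r j)) i))) =
      fun δ => fam n δ (fun j => closedBall (z j) η) (fun j => (ball (c j) (r j))ᶜ) := by
    funext δ
    exact disc_gball_append δ z (fun _ => η) c r (fun _ => hη0) hr
  have hN' : Tendsto (fun δ => Pr (n + n) (fam n δ (fun j => closedBall (z j) η)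
      (fun j => (ball (c j) (r j))ᶜ)) (EVEN2 n ∩ CROSS n)) (𝓝[>] 0)
      (𝓝 (lam₁ (Fin.append (fun j => (z j, η)) (fun j => (c j, -r j))))) := by
    refine hN.congr fun δ => ?_
    exact congrArg (fun K => Pr (n + n) K (EVEN2 n ∩ CROSS n)) (congrFun hfam δ)
  have hD' : Tendsto (fun δ => Pr (n + n) (fam n δ (fun j => closedBall (z j) η)
      (fun j => (ball (c j) (r j))ᶜ)) (CROSS n)) (𝓝[>] 0)
      (𝓝 (lam₂ (Fin.append (fun j => (z j, η)) (fun j => (c j, -r j))))) := by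
    refine hD.congr fun δ => ?_
    exact congrArg (fun K => Pr (n + n) K (CROSS n)) (congrFun hfam δ)
  exact tendsto_nhds_unique hη (hN'.div hD' (h₂pos _ hrad).ne')

/-- `η ↦ η/(N² - η²)` tends to `0` from the right. [folklore] -/
theorem tendsto_div_sub_sq (N : ℝ) (hN : N ≠ 0) :
    Tendsto (fun η : ℝ => η / (N ^ 2 - η ^ 2)) (𝓝[>] 0) (𝓝 0) := by
  have h1 : Tendsto (fun η : ℝ => η) (𝓝 (0:ℝ)) (𝓝 0) := tendsto_id
  have h2 : Tendsto (fun η : ℝ => N ^ 2 - η ^ 2) (𝓝 (0:ℝ)) (𝓝 (N ^ 2 - 0 ^ 2)) :=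
    tendsto_const_nhds.sub (tendsto_id.pow 2)
  have h3 := h1.div h2 (by simpa using pow_ne_zero 2 hN)
  rw [zero_div] at h3
  exact h3.mono_left nhdsWithin_le_nhds

/-- **z*-side.**  The IMAGE inner family `ginv (z_j, η)` is admissible at `z* = z/‖z‖²` for the inverted system
`(c*, r*)`, so if `BFam n c* r* z* t*` holds, A gives `lam₁, lam₂` (inversion invariant) with `lam₂ > 0`, then
the SAME function `η ↦ lam₁(p_η)/lam₂(p_η)` of the un-inverted data tends to `t*`. [cite: CamiaFeng2025, §3.2.3] -/
theorem tendsto_lam_ratio_of_BFam_star {n : ℕ} {z : Fin n → EuclideanSpace ℝ (Fin 3)} {r : ℝ} {t : ℝ}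
    (hz : ∀ j, z j ≠ 0) (hr : 0 < r) (hrz : ∀ j, r < ‖z j‖)
    (hB : BFam n (fun j => (‖z j‖ ^ 2 - r ^ 2)⁻¹ • z j) (fun j => r / (‖z j‖ ^ 2 - r ^ 2))
      (fun j => inversion 0 1 (z j)) t)
    {lam₁ lam₂ : (Fin (n + n) → EuclideanSpace ℝ (Fin 3) × ℝ) → ℝ}
    (h₁ : BallLaw (n + n) (EVEN2 n ∩ CROSS n) lam₁) (h₂ : BallLaw (n + n) (CROSS n) lam₂)
    (h₂pos : ∀ p : Fin (n + n) → EuclideanSpace ℝ (Fin 3) × ℝ, (∀ i, (p i).2 ≠ 0) → 0 < lam₂ p) :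
    Tendsto (fun η => lam₁ (Fin.append (fun j => (z j, η)) (fun j => (z j, -r))) /
      lam₂ (Fin.append (fun j => (z j, η)) (fun j => (z j, -r)))) (𝓝[>] 0) (𝓝 t) := by
  -- the image inner family is admissible
  have hadm : ∀ᶠ η in 𝓝[>] (0:ℝ), ∀ j, 0 < η / (‖z j‖ ^ 2 - η ^ 2) ∧
      inversion 0 1 (z j) ∈ ball ((‖z j‖ ^ 2 - η ^ 2)⁻¹ • z j) (η / (‖z j‖ ^ 2 - η ^ 2) / 2) := by
    refine eventually_all.2 fun j => ?_
    have hN : 0 < ‖z j‖ := norm_pos_iff.2 (hz j)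
    filter_upwards [Ioo_mem_nhdsGT (half_pos hN)] with η hη
    have hηN : η < ‖z j‖ := by linarith [hη.2]
    exact ⟨ginv_radius_pos hη.1 hηN, inversion_mem_ball_image_half hη.1 hη.2⟩
  have hlt : ∀ᶠ η in 𝓝[>] (0:ℝ), ∀ j, η < ‖z j‖ := by
    refine eventually_all.2 fun j => ?_
    filter_upwards [Ioo_mem_nhdsGT (norm_pos_iff.2 (hz j))] with η hη using hη.2
  obtain ⟨Λ, hΛ, hΛt⟩ := hB (fun η j => (‖z j‖ ^ 2 - η ^ 2)⁻¹ • z j)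
    (fun η j => η / (‖z j‖ ^ 2 - η ^ 2)) (fun j => tendsto_div_sub_sq ‖z j‖ (norm_ne_zero_iff.2 (hz j))) hadm
  refine hΛt.congr' ?_
  filter_upwards [hΛ, hadm, hlt, self_mem_nhdsWithin] with η hη hadmη hltη hη0
  have hη0 : 0 < η := hη0
  -- data of the un-inverted configuration and its guard
  have hrad := radii_ne_zero_append z hη0.ne' hr.ne'
  have hguard := guard_append z hη0 hltη hr hrz
  -- radii of the image data are non-zero
  have hr' : ∀ j, 0 < r / (‖z j‖ ^ 2 - r ^ 2) := fun j => ginv_radius_pos hr (hrz j)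
  have hrad' : ∀ i, (ginv (Fin.append (fun j => (z j, η)) (fun j => (z j, -r)) i)).2 ≠ 0 := by
    intro i
    have := congrFun (ginv_append_data z η r) i
    rw [this]
    refine Fin.addCases (fun j => ?_) (fun j => ?_) i
    · simp only [Fin.append_left]; exact (hadmη j).1.ne'
    · simp only [Fin.append_right]; exact neg_ne_zero.2 (hr' j).ne'
  -- A at the image data, transported back by the inversion clause
  have hN := h₁.2.1 _ hrad'
  have hD := h₂.2.1 _ hrad'
  rw [h₁.2.2.2.2.2 _ hguard] at hN
  rw [h₂.2.2.2.2.2 _ hguard] at hD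
  -- the image data discretise to the `fam` of the image inner balls and the exteriors of the image balls
  have hfam : ∀ δ, (fun i => disc δ (gball (ginv (Fin.append (fun j => (z j, η)) (fun j => (z j, -r)) i)))) =
      fam n δ (fun j => closedBall ((‖z j‖ ^ 2 - η ^ 2)⁻¹ • z j) (η / (‖z j‖ ^ 2 - η ^ 2)))
        (fun j => (ball ((‖z j‖ ^ 2 - r ^ 2)⁻¹ • z j) (r / (‖z j‖ ^ 2 - r ^ 2)))ᶜ) := by
    intro δ
    have h := disc_gball_append δ (fun j => (‖z j‖ ^ 2 - η ^ 2)⁻¹ • z j)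
      (fun j => η / (‖z j‖ ^ 2 - η ^ 2)) (fun j => (‖z j‖ ^ 2 - r ^ 2)⁻¹ • z j)
      (fun j => r / (‖z j‖ ^ 2 - r ^ 2)) (fun j => (hadmη j).1) hr'
    rw [← h]
    funext i
    exact congrArg (fun p => disc δ (gball p)) (congrFun (ginv_append_data z η r) i)
  have hN' : Tendsto (fun δ => Pr (n + n) (fam n δ
      (fun j => closedBall ((‖z j‖ ^ 2 - η ^ 2)⁻¹ • z j) (η / (‖z j‖ ^ 2 - η ^ 2)))
      (fun j => (ball ((‖z j‖ ^ 2 - r ^ 2)⁻¹ • z j) (r / (‖z j‖ ^ 2 - r ^ 2)))ᶜ)) (EVEN2 n ∩ CROSS n))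
      (𝓝[>] 0) (𝓝 (lam₁ (Fin.append (fun j => (z j, η)) (fun j => (z j, -r))))) := by
    refine hN.congr fun δ => ?_
    exact congrArg (fun K => Pr (n + n) K (EVEN2 n ∩ CROSS n)) (hfam δ)
  have hD' : Tendsto (fun δ => Pr (n + n) (fam n δ
      (fun j => closedBall ((‖z j‖ ^ 2 - η ^ 2)⁻¹ • z j) (η / (‖z j‖ ^ 2 - η ^ 2)))
      (fun j => (ball ((‖z j‖ ^ 2 - r ^ 2)⁻¹ • z j) (r / (‖z j‖ ^ 2 - r ^ 2)))ᶜ)) (CROSS n))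
      (𝓝[>] 0) (𝓝 (lam₂ (Fin.append (fun j => (z j, η)) (fun j => (z j, -r))))) := by
    refine hD.congr fun δ => ?_
    exact congrArg (fun K => Pr (n + n) K (CROSS n)) (hfam δ)
  exact tendsto_nhds_unique hη (hN'.div hD' (h₂pos _ hrad).ne')

/-! ### `q` is inversion invariant -/

/-- **The even-pattern factor is invariant under the unit inversion** (given A and `CrossLawPositive`):
the B(ii) targets at `z` for the system `(z, r)` and at `z*` for the image system `(c*, r*)` coincide.
[cite: CamiaFeng2025, §3.2.3] -/
theorem bFam_target_star_eq (hPos : CrossLawPositive) (hA : ArmDressing.BallConnectivityMoebius) {n : ℕ}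
    {z : Fin n → EuclideanSpace ℝ (Fin 3)} {r : ℝ} (hz : ∀ j, z j ≠ 0) (hr : 0 < r) (hrz : ∀ j, r < ‖z j‖)
    {t t' : ℝ} (hB : BFam n z (fun _ => r) z t)
    (hB' : BFam n (fun j => (‖z j‖ ^ 2 - r ^ 2)⁻¹ • z j) (fun j => r / (‖z j‖ ^ 2 - r ^ 2))
      (fun j => inversion 0 1 (z j)) t') : t' = t := by
  obtain ⟨lam₁, h₁⟩ := ballConnectivityMoebius_iff.1 hA (n + n) (EVEN2 n ∩ CROSS n)
  obtain ⟨lam₂, h₂⟩ := ballConnectivityMoebius_iff.1 hA (n + n) (CROSS n)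
  have h₂pos : ∀ p : Fin (n + n) → EuclideanSpace ℝ (Fin 3) × ℝ, (∀ i, (p i).2 ≠ 0) → 0 < lam₂ p :=
    fun p hp => lam_cross_pos hPos h₂ p hp
  have H1 := tendsto_lam_ratio_of_BFam (c := z) (r := fun _ => r) (fun _ => hr) hB h₁ h₂ h₂pos
  have H2 := tendsto_lam_ratio_of_BFam_star hz hr hrz hB' h₁ h₂ h₂pos
  exact tendsto_nhds_unique H2 H1

/-- Registered bookkeeping stub `stub_invQTransport` of the skeleton (= `bFam_target_star_eq`), through which
this file lands. [cite: CamiaFeng2025, §3.2.3] -/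
theorem stub_invQTransport : CrossLawPositive → ArmDressing.BallConnectivityMoebius → ∀ (n : ℕ) (z : Fin n → EuclideanSpace ℝ (Fin 3)) (r : ℝ), (∀ j, z j ≠ 0) → 0 < r → (∀ j, r < ‖z j‖) → ∀ t t' : ℝ, BFam n z (fun _ => r) z t → BFam n (fun j => (‖z j‖ ^ 2 - r ^ 2)⁻¹ • z j) (fun j => r / (‖z j‖ ^ 2 - r ^ 2)) (fun j => EuclideanGeometry.inversion 0 1 (z j)) t' → t' = t :=
  fun hPos hA _ _ _ hz hr hrz _ _ hB hB' => bFam_target_star_eq hPos hA hz hr hrz hB hB'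

end Summit.CriticalPhenomena.Ising3DConformalLimit.Cruxes.ArmDressingGlue.InvBook

end
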